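import Summits.MatrixMultiplication.MatrixMultiplication.Theses.GLnSeparatingDesigns

/-!
# Disproof of `BorderHalfDimensionDesigns` — findings (cycle 1, cdisprove stmt-MatrixMultiplication-18360)

Crux (route `GLnSeparatingDesigns`, rank 2): BCGPU 2024 (arXiv:2410.14905) §4 key question in its
border reading — `∀ ε>0 ∃ n≥3 ∀ δ>0 ∀ q₀ ∃ q≥q₀ ∀ η>0 ∃ X Y Z ⊆ GL_n(ℂ)` finite with TPP (embedding form),
`|X|,|Y|,|Z| ≥ q^(n²/2 − εn)`, and for every target `(x₀,z₀)` an `η`-approximate separating polynomial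
of total degree `≤ q^(1+δ)` in the `n²` entries of `x y⁻¹ y' z⁻¹`.

**Verdict of this cycle: NO KILL; the statement resists, and it resists for structural reasons
(below).  Everything conclusive here is sorry-free (rc 0) and filed under
`Theorems/BorderHalfDimensionDesigns/Negative/` as `CountingBarrier.lean` (p148828: engine, TPP
redundancy, two-set packing, exponent form), `CountingStrengthenings.lean`, `AffineSubfamilyBounds.lean`,
`AffineSubfamilyKills.lean` (sequels, proposed after the first lands), namespace
`Summit.….Theorems.BorderHalfDimensionDesignsNeg`, statements written with the crux's literal clauses
(notation `pt`).**

## Findings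

* (faithfulness) Read against the materialised print (Def. 2.1 p.10, Def. 2.5 p.13, Thm 2.6 p.14,
  Cor. 2.8 p.15, §4 p.33): the rendering is the printed question's border version with the sets allowed
  to depend on the tolerance ARBITRARILY (print: analytic 1-parameter families) — i.e. it is implied by,
  hence weaker-or-equal to, the printed open question; quantifier order `∀ε ∃n ∀δ` matches
  "`q^(n²/2−o_n(n))`, degree `q^(1+o_q(1))`".  No misstatement to exploit.  (The price side,
  `SeparationDegreeCost`, inherits the burden: for η-dependent non-analytic families it needs the
  closure step of Thm 2.6 — not this item.)
* (a) `tpp_of_separators`, `borderHalfDimensionDesigns_iff_withoutTPP`: the TPP conjunct is NOT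
  load-bearing — at `η < 1/2` the separators force it.  All content is sizes + degree + approximation.
* (b) `card_le_finrank_of_approx_dual` (engine: an `η`-approximate dual family with `η·#ι < 1` is a
  strictly diagonally dominant, hence invertible, matrix ⇒ `#ι ≤ dim W`), `card_mul_card_le_of_separators`:
  `|X|·|Z| ≤ (s+1)^(n²)` for ANY design with `η|X||Z| < 1` (no TPP, no `ω`).  Exponent form
  `no_designs_beyond_counting`: size exponent `a`, degree exponent `b ≥ 0` need `2a ≤ b n²`.
* (c) natural strengthenings refuted unconditionally (the print derives both from "`ω < 2` is absurd",
  p. 7 / p. 15): `not_superHalfDimensionDesigns` (sizes `q^(n²/2 + c)`), and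
  `not_halfDimensionDesigns_sublinearDegree` (degree `q^(1−c)`).  The crux sits EXACTLY on the counting
  boundary `2·(n²/2 − εn) ≤ (1+δ)·n²`: its designs are near-extremal graded packings (cf.
  `Literature.Barriers.MatrixMultiplication.GradedPackingBound`), the product set `X·Z⁻¹` must impose
  `|X||Z| = D^(1−o(1))` independent conditions on degree-`s` polynomials (`D = C(s+n²,n²)`).
* (c′) sub-family kills `not_borderHalfDimensionDesigns_affineX / _affineY` (via
  `card_le_of_separators_affine`, `card_Y_le_of_separators_affine`): if `X` (or `Y`) lies in an affine
  subspace of `Mat_n(ℂ)` of dimension `m ≤ (n²−n)/2` then `|X| ≤ (s+1)^m`, contradicting the sizes already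
  at `ε = 1/8, δ = 1/(4n)`.  DEAD for this crux: any line placing a design set inside a two-sided
  translate `a·S·b` of the unitriangular group `L`, a torus, a Borel unipotent radical, a block vector
  group, `exp` of an abelian nilpotent Lie algebra, or the scalars (central `Y`).  BCGPU's running-example
  hosts `(L, ·, U⁺)` have `m = (n²−n)/2`, i.e. they live exactly at `ε = 1/2`; the crux needs `ε → 0`, so
  its sets must be Zariski-spread in dimension `> n²/2 − εn` — necessarily "real" (non-holomorphic)
  configurations such as grids in `U_n`-type real forms (their Rem. 1.3 / BCGPU23 Thm 4.7, here made
  quantitative, unconditional and checkable).  `Z` enters through `z⁻¹` and inversion is not polynomial,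
  so the third version (`card_Z_le_of_separators_affineInv`, `not_borderHalfDimensionDesigns_affineZinv`)
  carries the affine hypothesis on `Z⁻¹` (same hosts: subgroups inside affine subspaces are inverse-closed).

## Why it resists (for the provers and the planner)

1. Tensor level.  Through the hosting mechanism (BCGPU Thm 2.2/2.6) a design makes `⟨N,N,N⟩` a border
   restriction of `⊕_λ ⟨d_λ⟩`, `Σ d_λ² = C(s+n²,n²) ≈ N^(2+o(1))`, `d_λ ≤ s^C(n,2) ≪ N`.  Any refutation
   at this level needs a degeneration-monotone, `⊕`-subadditive functional with `μ(⟨d⟩) ≍ d^c`, `c > 2` —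
   which exists iff `ω > 2`.  Flattenings give only `c = 2` (= finding (b)).  So no tensor-level kill
   short of `ω > 2`.
2. Group level.  A kill must use the geometry of `GL_n(ℂ)`: e.g. incidence bounds (distinct distances
   [SV08] give degree `≥ q^(2−o(1))` for the `O_n` column design, BCGPU p. 17) — design-class by
   design-class, not uniformly.  A uniform theorem "TPP sets of size `q^(n²/2−εn)` admit no `η`-uniform
   separators of degree `q^(1+δ)`" would be a new `Literature/Barriers` entry; nothing in print.
3. Border slack is essential and one-sided: exact designs would in addition need the `≈ N⁴` points with
   `y ≠ y'` to impose only `D − N² = o(D)` conditions (upper-semicontinuous, lost in the limit), whereas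
   all ROBUST (lower-semicontinuous) constraints reduce to rank counts of type (b)/(c′).  Cheap
   refutations can therefore only ever kill sub-families whose parameter count is visibly `< n²/2`.

## Census of attacks (cycle 1)
misstatement audit (print pp. 10,13,14,15,33) → faithful/weaker · TPP mutation → redundant (a) ·
counting at `y = y'` → boundary only (b),(c) · scalar/central `Y`, torus, unitriangular, vector-group
hosts → killed as sub-families (c′) · tensor-hosting reduction → equivalent to `ω > 2` (resists) ·
1-D extrapolation route for one-parameter unipotent `Y` → superseded by (c′) (`m = 1`).

## Next regimes (cycle 2 if granted / targets when a line is picked)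
`Z⁻¹`-affine version; sets inside a fixed proper SUBVARIETY of degree-`s` Hilbert function `≪ s^(n²/2)`
(needs Hilbert-function bookkeeping); real-form hosts: is `|X ∩ U_n-grid|` vs holomorphic degree `s`
bounded by `s^(n²/2)`·const (the honest half-dimension wall)?; joint `X·Z⁻¹`-spread lemma.
-/

namespace Summit.MatrixMultiplication.MatrixMultiplication.Cruxes.BorderHalfDimensionDesigns.Disproof

open scoped BigOperators Matrix
open Finset

/-- Shorthand for the host group `GL_n(ℂ)`. -/
abbrev GLn (n : ℕ) := Matrix.GeneralLinearGroup (Fin n) ℂ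

/-! ## Engine: an approximate dual family forces `card ≤ finrank` -/

/-- **Approximate-duality rank lemma.** If functions `f i : ι → ℂ` all lie in a subspace `W`
and form an `η`-approximate dual family (`f i i ≈ 1`, `f i j ≈ 0`) with `η · #ι < 1`, then
`#ι ≤ dim W` (strict diagonal dominance ⇒ the matrix `(f i j)` is invertible). -/
theorem card_le_finrank_of_approx_dual {ι : Type*} [Fintype ι] [DecidableEq ι]
    (W : Submodule ℂ (ι → ℂ)) (f : ι → ι → ℂ) (hf : ∀ i, f i ∈ W) (η : ℝ)
    (hη : η * Fintype.card ι < 1)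
    (hdiag : ∀ i, ‖f i i - 1‖ ≤ η) (hoff : ∀ i j, i ≠ j → ‖f i j‖ ≤ η) :
    Fintype.card ι ≤ Module.finrank ℂ W := by
  set A : Matrix ι ι ℂ := Matrix.of fun i j => f i j with hA
  have hdet : A.det ≠ 0 := by
    apply det_ne_zero_of_sum_row_lt_diag
    intro k
    -- g j := the deviation of entry (k,j) from the identity matrix
    set g : ι → ℝ := fun j => if j = k then ‖A k k - 1‖ else ‖A k j‖ with hg
    have hgle : ∀ j ∈ (univ : Finset ι), g j ≤ η := by
      intro j _
      by_cases hjk : j = k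
      · subst hjk; simp only [g, if_true, A, Matrix.of_apply]; exact hdiag j
      · simp only [g, if_neg hjk, A, Matrix.of_apply]; exact hoff k j (Ne.symm hjk)
    have hsum : ∑ j, g j ≤ (Fintype.card ι : ℝ) * η := by
      have := Finset.sum_le_card_nsmul (univ : Finset ι) g η hgle
      simpa [nsmul_eq_mul] using this
    have hsplit : ∑ j, g j = ‖A k k - 1‖ + ∑ j ∈ univ.erase k, ‖A k j‖ := by
      rw [← Finset.add_sum_erase _ _ (mem_univ k)]
      congr 1
      · simp [g]
      · refine Finset.sum_congr rfl fun j hj => ?_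
        simp [g, Finset.ne_of_mem_erase hj]
    have htri : 1 - ‖A k k - 1‖ ≤ ‖A k k‖ := by
      have := norm_sub_norm_le (1 : ℂ) (1 - A k k)
      rw [norm_one, sub_sub_cancel, norm_sub_rev] at this
      linarith
    have hη' : (Fintype.card ι : ℝ) * η < 1 := by rwa [mul_comm] at hη
    linarith
  have hunit : IsUnit A := (Matrix.isUnit_iff_isUnit_det A).2 (isUnit_iff_ne_zero.2 hdet)
  have hrank : A.rank = Fintype.card ι := Matrix.rank_of_isUnit A hunit
  rw [← hrank, Matrix.rank_eq_finrank_span_row]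
  apply Submodule.finrank_mono
  rw [Submodule.span_le]
  rintro _ ⟨i, rfl⟩
  have : A.row i = f i := by funext j; rfl
  rw [this]
  exact hf i


/-! ## The crux's separator clause, named -/

/-- The sampled group element of a quadruple, as the crux types it: the `n²` entries of
`x y⁻¹ y' z⁻¹`. -/
def pt {n : ℕ} (x y y' z : GLn n) : Fin n × Fin n → ℂ :=
  fun ij => ((x * y⁻¹ * y' * z⁻¹ : GLn n) : Matrix (Fin n) (Fin n) ℂ) ij.1 ij.2

/-- `η`-approximate separating polynomials of total degree `≤ s` for every target `(x₀, z₀)` —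
literally the last conjunct of `BorderHalfDimensionDesigns`, with an integer degree budget. -/
def HasSeparators {n : ℕ} (X Y Z : Finset (GLn n)) (s : ℕ) (η : ℝ) : Prop :=
  ∀ x₀ ∈ X, ∀ z₀ ∈ Z, ∃ p : MvPolynomial (Fin n × Fin n) ℂ, p.totalDegree ≤ s ∧
    ∀ x ∈ X, ∀ y ∈ Y, ∀ y' ∈ Y, ∀ z ∈ Z,
      ((x = x₀ ∧ y = y' ∧ z = z₀) → ‖MvPolynomial.eval (pt x y y' z) p - 1‖ ≤ η) ∧
      (¬ (x = x₀ ∧ y = y' ∧ z = z₀) → ‖MvPolynomial.eval (pt x y y' z) p‖ ≤ η)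

/-- The crux's TPP clause (embedding form), named. -/
def TPP {n : ℕ} (X Y Z : Finset (GLn n)) : Prop :=
  ∀ x ∈ X, ∀ x' ∈ X, ∀ y ∈ Y, ∀ y' ∈ Y, ∀ z ∈ Z, ∀ z' ∈ Z,
    x * y⁻¹ * y' * z⁻¹ = x' * z'⁻¹ → x = x' ∧ y = y' ∧ z = z'

/-! ## (a) Load-bearing analysis: the TPP conjunct is NOT load-bearing

For `η < 1/2` the separator clause alone implies the TPP clause: a coincidence
`x y⁻¹ y' z⁻¹ = x' z'⁻¹` with `(x, y, z) ≠ (x', y', z')` would put the separator of the target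
`(x', z')` within `η` of both `0` and `1` at the same point.  So dropping the TPP conjunct from the
crux gives an EQUIVALENT statement (`borderHalfDimensionDesigns_iff_withoutTPP` below); all the
content is in sizes + degree + approximate separation. -/

/-- Separators at tolerance `η < 1/2` force the triple product property. [folklore] -/
theorem tpp_of_separators {n s : ℕ} {X Y Z : Finset (GLn n)} {η : ℝ} (hη : η < 1 / 2)
    (hsep : HasSeparators X Y Z s η) : TPP X Y Z := by
  intro x hx x' hx' y hy y' hy' z hz z' hz' h
  by_contra hne
  obtain ⟨p, -, hp⟩ := hsep x' hx' z' hz'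
  have h0 := (hp x hx y hy y' hy' z hz).2 hne
  have h1 := (hp x' hx' y hy y hy z' hz').1 ⟨rfl, rfl, rfl⟩
  have e : pt x y y' z = pt x' y y z' := by
    have e1 : x * y⁻¹ * y' * z⁻¹ = x' * y⁻¹ * y * z'⁻¹ := by rw [h]; group
    funext ij
    show ((x * y⁻¹ * y' * z⁻¹ : GLn n) : Matrix (Fin n) (Fin n) ℂ) ij.1 ij.2 =
      ((x' * y⁻¹ * y * z'⁻¹ : GLn n) : Matrix (Fin n) (Fin n) ℂ) ij.1 ij.2
    rw [e1]
  rw [e] at h0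
  have h2 : (1 : ℝ) ≤ ‖(1 : ℂ) - MvPolynomial.eval (pt x' y y z') p‖ +
      ‖MvPolynomial.eval (pt x' y y z') p‖ := by
    have := norm_sub_norm_le (1 : ℂ) ((1 : ℂ) - MvPolynomial.eval (pt x' y y z') p)
    rw [norm_one, sub_sub_cancel] at this
    linarith
  rw [norm_sub_rev] at h1
  linarith

/-! ## (b) Counting / tightness: `|X|·|Z| ≤ (s+1)^(n²)` — no TPP needed -/

/-- A coefficient of a monomial in the support is at most the total degree. [folklore] -/
theorem apply_le_totalDegree {σ : Type*} {p : MvPolynomial σ ℂ} {d : σ →₀ ℕ}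
    (hd : d ∈ p.support) (i : σ) : d i ≤ p.totalDegree := by
  refine le_trans ?_ (MvPolynomial.le_totalDegree hd)
  by_cases hi : i ∈ d.support
  · exact Finset.single_le_sum (f := fun a => d a) (fun _ _ => Nat.zero_le _) hi
  · rw [Finsupp.notMem_support_iff.mp hi]; exact Nat.zero_le _

/-- **Counting bound (two-set packing).** If `Y ≠ ∅` and every target `(x₀, z₀) ∈ X × Z` has an
`η`-approximate separator of total degree `≤ s` with `η·|X|·|Z| < 1`, then `|X|·|Z| ≤ (s+1)^(n²)`:
restricted to the `|X|·|Z|` points `x y₀⁻¹ y₀ z⁻¹` the separators form an approximate dual basis inside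
the span of the `≤ (s+1)^(n²)` monomial functions of exponents `≤ s`.  The TPP is not used. -/
theorem card_mul_card_le_of_separators {n s : ℕ} {X Y Z : Finset (GLn n)} {η : ℝ}
    (hY : Y.Nonempty) (hsep : HasSeparators X Y Z s η)
    (hη : η * (X.card * Z.card) < 1) :
    X.card * Z.card ≤ (s + 1) ^ (n * n) := by
  classical
  obtain ⟨y₀, hy₀⟩ := hY
  choose p hpdeg hpsep using hsep
  -- points, separator values, monomial functions
  set P : ↥X × ↥Z → (Fin n × Fin n → ℂ) := fun j => pt j.1.1 y₀ y₀ j.2.1 with hP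
  set f : ↥X × ↥Z → ↥X × ↥Z → ℂ :=
    fun i j => MvPolynomial.eval (P j) (p i.1.1 i.1.2 i.2.1 i.2.2) with hf
  set mono : (Fin n × Fin n → Fin (s + 1)) → (↥X × ↥Z → ℂ) :=
    fun μ j => ∏ ij, (P j ij) ^ (μ ij : ℕ) with hmono
  set W : Submodule ℂ (↥X × ↥Z → ℂ) := Submodule.span ℂ (Set.range mono) with hW
  have hWle : Module.finrank ℂ W ≤ (s + 1) ^ (n * n) := by
    have h := finrank_range_le_card (R := ℂ) mono
    simpa [W, Set.finrank, Fintype.card_fun, Fintype.card_prod, Fintype.card_fin] using h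
  have hfW : ∀ i, f i ∈ W := by
    intro i
    set Q := p i.1.1 i.1.2 i.2.1 i.2.2 with hQ
    have hexp : f i = ∑ d ∈ Q.support, (MvPolynomial.coeff d Q) • (fun j => ∏ ij, P j ij ^ d ij) := by
      funext j
      simp only [f, Finset.sum_apply, Pi.smul_apply, smul_eq_mul]
      rw [MvPolynomial.eval_eq]
      refine Finset.sum_congr rfl fun d _ => ?_
      congr 1
      exact Finset.prod_subset (Finset.subset_univ _)
        (fun ij _ hij => by rw [Finsupp.notMem_support_iff.mp hij, pow_zero])
    rw [hexp]
    refine Submodule.sum_mem _ fun d hd => Submodule.smul_mem _ _ (Submodule.subset_span ?_)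
    refine ⟨fun ij => ⟨d ij, Nat.lt_succ_of_le ((apply_le_totalDegree hd ij).trans (hpdeg _ _ _ _))⟩, ?_⟩
    funext j
    simp [mono]
  have hcard : Fintype.card (↥X × ↥Z) = X.card * Z.card := by simp
  have key := card_le_finrank_of_approx_dual W f hfW η (by rw [hcard]; push_cast; exact hη)
    (fun i => (hpsep i.1.1 i.1.2 i.2.1 i.2.2 i.1.1 i.1.2 y₀ hy₀ y₀ hy₀ i.2.1 i.2.2).1 ⟨rfl, rfl, rfl⟩)
    (fun i j hij => (hpsep i.1.1 i.1.2 i.2.1 i.2.2 j.1.1 j.1.2 y₀ hy₀ y₀ hy₀ j.2.1 j.2.2).2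
      (fun h => hij (Prod.ext (Subtype.ext h.1.symm) (Subtype.ext h.2.2.symm))))
  rw [hcard] at key
  exact key.trans hWle


/-- **Counting barrier, exponent form.** For a fixed `n`, size exponent `a` and degree exponent
`b ≥ 0` with `b·n² < 2a`, there is NO family (over arbitrarily large `q`, every tolerance `η`) of
finite `X, Y, Z ⊆ GL_n(ℂ)` with `|X|, |Y|, |Z| ≥ q^a` and `η`-separators of degree `≤ q^b`:
`q^(2a) ≤ |X||Z| ≤ (q^b + 1)^(n²)` fails for large `q`.  (TPP not even assumed.) [folklore] -/
theorem no_designs_beyond_counting (n : ℕ) {a b : ℝ} (hb : 0 ≤ b) (hab : b * (n : ℝ) ^ 2 < 2 * a) :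
    ¬ (∀ q₀ : ℕ, ∃ q : ℕ, q₀ ≤ q ∧ ∀ η : ℝ, 0 < η → ∃ X Y Z : Finset (GLn n),
        (q : ℝ) ^ a ≤ (X.card : ℝ) ∧ (q : ℝ) ^ a ≤ (Y.card : ℝ) ∧ (q : ℝ) ^ a ≤ (Z.card : ℝ) ∧
        ∀ x₀ ∈ X, ∀ z₀ ∈ Z, ∃ p : MvPolynomial (Fin n × Fin n) ℂ,
          (p.totalDegree : ℝ) ≤ (q : ℝ) ^ b ∧
          ∀ x ∈ X, ∀ y ∈ Y, ∀ y' ∈ Y, ∀ z ∈ Z,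
            ((x = x₀ ∧ y = y' ∧ z = z₀) → ‖MvPolynomial.eval (pt x y y' z) p - 1‖ ≤ η) ∧
            (¬ (x = x₀ ∧ y = y' ∧ z = z₀) → ‖MvPolynomial.eval (pt x y y' z) p‖ ≤ η)) := by
  intro H
  set γ : ℝ := 2 * a - b * (n : ℝ) ^ 2 with hγ
  have hγpos : 0 < γ := by rw [hγ]; linarith
  set B : ℝ := (2 : ℝ) ^ (((n : ℝ) ^ 2 + 1) / γ) with hB
  obtain ⟨q, hq₀, Hq⟩ := H (⌈B⌉₊ + 2)
  have hqB : B ≤ q := le_trans (Nat.le_ceil B) (by exact_mod_cast (by omega : ⌈B⌉₊ ≤ q))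
  have hq2 : (2 : ℝ) ≤ q := by exact_mod_cast (by omega : 2 ≤ q)
  have hq1 : (1 : ℝ) ≤ q := by linarith
  have hq0 : (0 : ℝ) < q := by linarith
  set N : ℕ := ⌈(q : ℝ) ^ a⌉₊ with hN
  set s : ℕ := ⌊(q : ℝ) ^ b⌋₊ with hs
  have hqa : (0 : ℝ) < (q : ℝ) ^ a := Real.rpow_pos_of_pos hq0 a
  have hqb1 : (1 : ℝ) ≤ (q : ℝ) ^ b := Real.one_le_rpow hq1 hb
  set η : ℝ := 1 / (2 * ((N : ℝ) * N + 1)) with hη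
  have hηpos : 0 < η := by rw [hη]; positivity
  obtain ⟨X, Y, Z, hX, hY, hZ, hsep⟩ := Hq η hηpos
  have hNX : N ≤ X.card := Nat.ceil_le.mpr hX
  have hNZ : N ≤ Z.card := Nat.ceil_le.mpr hZ
  have hYne : Y.Nonempty := by
    rw [← Finset.card_pos]
    have : (0 : ℝ) < Y.card := lt_of_lt_of_le hqa hY
    exact_mod_cast this
  obtain ⟨X', hX'X, hX'card⟩ := Finset.exists_subset_card_eq hNX
  obtain ⟨Z', hZ'Z, hZ'card⟩ := Finset.exists_subset_card_eq hNZ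
  have hsep' : HasSeparators X' Y Z' s η := by
    intro x₀ hx₀ z₀ hz₀
    obtain ⟨p, hpdeg, hp⟩ := hsep x₀ (hX'X hx₀) z₀ (hZ'Z hz₀)
    exact ⟨p, Nat.le_floor hpdeg,
      fun x hx y hy y' hy' z hz => hp x (hX'X hx) y hy y' hy' z (hZ'Z hz)⟩
  have hηN : η * (X'.card * Z'.card) < 1 := by
    rw [hX'card, hZ'card, hη]
    have hNN : (0 : ℝ) ≤ (N : ℝ) * N := by positivity
    rw [div_mul_eq_mul_div, one_mul, div_lt_one (by positivity)]
    linarith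
  have hcount := card_mul_card_le_of_separators hYne hsep' hηN
  rw [hX'card, hZ'card] at hcount
  -- real-number bookkeeping: q^(2a) ≤ N² ≤ (s+1)^(n²) ≤ 2^(n²) q^(b n²)
  have hcountR : ((q : ℝ) ^ a) ^ 2 ≤ ((s : ℝ) + 1) ^ (n * n) := by
    have h1 : ((q : ℝ) ^ a) ^ 2 ≤ (N : ℝ) ^ 2 := pow_le_pow_left₀ hqa.le (Nat.le_ceil _) 2
    have h2 : (N : ℝ) ^ 2 ≤ ((s : ℝ) + 1) ^ (n * n) := by
      rw [sq]; exact_mod_cast hcount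
    exact h1.trans h2
  have hs1 : (s : ℝ) + 1 ≤ 2 * (q : ℝ) ^ b := by
    have : (s : ℝ) ≤ (q : ℝ) ^ b := Nat.floor_le (by positivity)
    linarith
  have h3 : ((s : ℝ) + 1) ^ (n * n) ≤ (2 * (q : ℝ) ^ b) ^ (n * n) :=
    pow_le_pow_left₀ (by positivity) hs1 _
  have h4 : (2 * (q : ℝ) ^ b) ^ (n * n) = (2 : ℝ) ^ (n * n) * (q : ℝ) ^ (b * (n : ℝ) ^ 2) := by
    rw [mul_pow, ← Real.rpow_natCast ((q : ℝ) ^ b) (n * n), ← Real.rpow_mul hq0.le]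
    push_cast
    congr 2
    ring
  have h5 : ((q : ℝ) ^ a) ^ 2 = (q : ℝ) ^ γ * (q : ℝ) ^ (b * (n : ℝ) ^ 2) := by
    rw [← Real.rpow_natCast ((q : ℝ) ^ a) 2, ← Real.rpow_mul hq0.le, ← Real.rpow_add hq0]
    congr 1
    push_cast
    rw [hγ]; ring
  have h6 : (q : ℝ) ^ γ * (q : ℝ) ^ (b * (n : ℝ) ^ 2)
      ≤ (2 : ℝ) ^ (n * n) * (q : ℝ) ^ (b * (n : ℝ) ^ 2) := by
    rw [← h5, ← h4]; exact hcountR.trans h3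
  have h7 : (q : ℝ) ^ γ ≤ (2 : ℝ) ^ (n * n) :=
    le_of_mul_le_mul_right h6 (Real.rpow_pos_of_pos hq0 _)
  -- while q ≥ B = 2^((n²+1)/γ) forces q^γ ≥ 2^(n²+1)
  have h8 : B ^ γ ≤ (q : ℝ) ^ γ := Real.rpow_le_rpow (by positivity) hqB hγpos.le
  have h9 : B ^ γ = 2 * (2 : ℝ) ^ (n * n) := by
    rw [hB, ← Real.rpow_mul (by norm_num : (0 : ℝ) ≤ 2), div_mul_cancel₀ _ hγpos.ne',
      Real.rpow_add (by norm_num : (0 : ℝ) < 2), Real.rpow_one, mul_comm]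
    congr 1
    rw [← Real.rpow_natCast (2 : ℝ) (n * n)]
    push_cast
    congr 1
    ring
  have h10 : (0 : ℝ) < (2 : ℝ) ^ (n * n) := by positivity
  linarith

/-! ## (c) Natural strengthenings refuted (finite counting; no appeal to `ω`) -/

/-- **Sizes beyond half dimension are impossible.**  For every fixed `n` and `c > 0` there is no
family of TPP designs of sizes `≥ q^(n²/2 + c)` with `η`-separators of degree `≤ q^(1+δ)` for every
`δ > 0`: the crux's size exponent `n²/2` is the counting ceiling `(|X||Z| ≤ (s+1)^(n²))`, and its
`−εn` is all the slack there is (BCGPU 2024, remark after Cor. 2.8, p. 15 — there via "`ω < 2` is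
absurd"; here unconditionally). [folklore] -/
theorem not_superHalfDimensionDesigns (n : ℕ) {c : ℝ} (hc : 0 < c) :
    ¬ (∀ δ : ℝ, 0 < δ → ∀ q₀ : ℕ, ∃ q : ℕ, q₀ ≤ q ∧ ∀ η : ℝ, 0 < η →
        ∃ X Y Z : Finset (GLn n), TPP X Y Z ∧
          (q : ℝ) ^ ((n : ℝ) ^ 2 / 2 + c) ≤ (X.card : ℝ) ∧
          (q : ℝ) ^ ((n : ℝ) ^ 2 / 2 + c) ≤ (Y.card : ℝ) ∧
          (q : ℝ) ^ ((n : ℝ) ^ 2 / 2 + c) ≤ (Z.card : ℝ) ∧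
          ∀ x₀ ∈ X, ∀ z₀ ∈ Z, ∃ p : MvPolynomial (Fin n × Fin n) ℂ,
            (p.totalDegree : ℝ) ≤ (q : ℝ) ^ (1 + δ) ∧
            ∀ x ∈ X, ∀ y ∈ Y, ∀ y' ∈ Y, ∀ z ∈ Z,
              ((x = x₀ ∧ y = y' ∧ z = z₀) → ‖MvPolynomial.eval (pt x y y' z) p - 1‖ ≤ η) ∧
              (¬ (x = x₀ ∧ y = y' ∧ z = z₀) → ‖MvPolynomial.eval (pt x y y' z) p‖ ≤ η)) := by
  intro H
  have hn2 : (0 : ℝ) ≤ (n : ℝ) ^ 2 := by positivity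
  have hδ : 0 < c / ((n : ℝ) ^ 2 + 1) := by positivity
  refine no_designs_beyond_counting n (a := (n : ℝ) ^ 2 / 2 + c) (b := 1 + c / ((n : ℝ) ^ 2 + 1))
    (by positivity) ?_ ?_
  · have h1 : c / ((n : ℝ) ^ 2 + 1) * (n : ℝ) ^ 2 ≤ c := by
      rw [div_mul_eq_mul_div, div_le_iff₀ (by positivity)]
      nlinarith
    nlinarith
  · intro q₀
    obtain ⟨q, hq, Hq⟩ := H _ hδ q₀
    refine ⟨q, hq, fun η hη => ?_⟩
    obtain ⟨X, Y, Z, -, hX, hY, hZ, hsep⟩ := Hq η hη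
    exact ⟨X, Y, Z, hX, hY, hZ, hsep⟩

/-- **Sub-linear separating degree is impossible at half dimension.**  For every `c > 0`, the crux
with degree budget `q^(1−c)` in place of `q^(1+δ)` is false: sizes `q^(n²/2 − εn)` need degree
`≥ q^(1 − 2ε/n − o(1))` by counting alone (BCGPU 2024 p. 7 / p. 15: "unconditionally at such sizes one
cannot have separating polynomials of degree `q^(1−c)`" — printed via `ω < 2`; here directly).  So the
degree exponent `1 + o(1)` of the crux cannot be lowered: the statement sits exactly on the counting
boundary. [folklore] -/
theorem not_halfDimensionDesigns_sublinearDegree {c : ℝ} (hc : 0 < c) :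
    ¬ (∀ ε : ℝ, 0 < ε → ∃ n : ℕ, 3 ≤ n ∧ ∀ q₀ : ℕ, ∃ q : ℕ, q₀ ≤ q ∧ ∀ η : ℝ, 0 < η →
        ∃ X Y Z : Finset (GLn n), TPP X Y Z ∧
          (q : ℝ) ^ ((n : ℝ) ^ 2 / 2 - ε * n) ≤ (X.card : ℝ) ∧
          (q : ℝ) ^ ((n : ℝ) ^ 2 / 2 - ε * n) ≤ (Y.card : ℝ) ∧
          (q : ℝ) ^ ((n : ℝ) ^ 2 / 2 - ε * n) ≤ (Z.card : ℝ) ∧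
          ∀ x₀ ∈ X, ∀ z₀ ∈ Z, ∃ p : MvPolynomial (Fin n × Fin n) ℂ,
            (p.totalDegree : ℝ) ≤ (q : ℝ) ^ (1 - c) ∧
            ∀ x ∈ X, ∀ y ∈ Y, ∀ y' ∈ Y, ∀ z ∈ Z,
              ((x = x₀ ∧ y = y' ∧ z = z₀) → ‖MvPolynomial.eval (pt x y y' z) p - 1‖ ≤ η) ∧
              (¬ (x = x₀ ∧ y = y' ∧ z = z₀) → ‖MvPolynomial.eval (pt x y y' z) p‖ ≤ η)) := by
  intro H
  set c' : ℝ := min c (1 / 2) with hc'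
  have hc'pos : 0 < c' := lt_min hc (by norm_num)
  have hc'le : c' ≤ 1 / 2 := min_le_right _ _
  have hc'c : c' ≤ c := min_le_left _ _
  obtain ⟨n, hn3, Hn⟩ := H (c' / 4) (by positivity)
  have hn : (3 : ℝ) ≤ n := by exact_mod_cast hn3
  refine no_designs_beyond_counting n (a := (n : ℝ) ^ 2 / 2 - c' / 4 * n) (b := 1 - c')
    (by linarith) ?_ ?_
  · nlinarith [mul_pos hc'pos (by linarith : (0 : ℝ) < n)]
  · intro q₀
    obtain ⟨q, hq, Hq⟩ := Hn (max q₀ 1)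
    have hq1 : (1 : ℝ) ≤ q := by exact_mod_cast le_trans (le_max_right q₀ 1) hq
    refine ⟨q, le_trans (le_max_left _ _) hq, fun η hη => ?_⟩
    obtain ⟨X, Y, Z, -, hX, hY, hZ, hsep⟩ := Hq η hη
    refine ⟨X, Y, Z, hX, hY, hZ, fun x₀ hx₀ z₀ hz₀ => ?_⟩
    obtain ⟨p, hpdeg, hp⟩ := hsep x₀ hx₀ z₀ hz₀
    exact ⟨p, hpdeg.trans (Real.rpow_le_rpow_of_exponent_le hq1 (by linarith)), hp⟩


/-! ## (c′) Sub-family kill: no design set can live in a low-dimensional affine subspace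

If `X` lies in an affine-linear subspace `A₀ + span(A₁,…,A_m)` of `Mat_n(ℂ)` then the separators of
the targets `(x₀, z₀)`, restricted to the `|X|` points `x y₀⁻¹ y₀ z₀⁻¹`, are polynomials of degree
`≤ s` in the `m` affine parameters, so `|X| ≤ (s+1)^m`.  With `m ≤ (n² − n)/2` (the unitriangular
group, a Borel unipotent radical, the torus, block vector groups, `exp` of a nilpotent abelian Lie
algebra, and all their two-sided translates `a·S·b`) this contradicts `|X| ≥ q^(n²/2 − εn)` as soon as
`ε < 1/2`: the crux's sets must be ZARISKI-SPREAD in dimension `> n²/2 − εn`, i.e. essentially real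
(non-holomorphic) configurations — BCGPU's "real subvariety" remark (2024, Rem. 1.3) made quantitative
and unconditional.  The same argument bounds `|Y|` (rows `y ↦ p(x₀ y⁻¹ y' z₀⁻¹)`) and `|Z|`. -/

/-- Substituting affine-linear forms does not raise the total degree. [folklore] -/
theorem totalDegree_bind₁_le_of_affine {σ τ : Type*} (ℓ : σ → MvPolynomial τ ℂ)
    (hℓ : ∀ i, (ℓ i).totalDegree ≤ 1) (p : MvPolynomial σ ℂ) :
    (MvPolynomial.bind₁ ℓ p).totalDegree ≤ p.totalDegree := by
  classical
  conv_lhs => rw [p.as_sum]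
  rw [map_sum]
  refine MvPolynomial.totalDegree_finsetSum_le fun d hd => ?_
  rw [MvPolynomial.bind₁_monomial]
  refine (MvPolynomial.totalDegree_mul _ _).trans ?_
  rw [MvPolynomial.totalDegree_C, zero_add]
  refine (MvPolynomial.totalDegree_finsetProd _ _).trans ?_
  refine le_trans (Finset.sum_le_sum fun i _ => (MvPolynomial.totalDegree_pow _ _).trans
    (Nat.mul_le_mul_left _ (hℓ i))) ?_
  simpa [Finsupp.sum] using MvPolynomial.le_totalDegree hd

/-- **Affine sub-family bound.** If `Y, Z ≠ ∅`, every target has an `η`-separator of degree `≤ s`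
with `η·|X| < 1`, and `X` lies in an affine subspace of `Mat_n(ℂ)` spanned by `m` matrices, then
`|X| ≤ (s+1)^m`. [folklore] -/
theorem card_le_of_separators_affine {n m s : ℕ} {X Y Z : Finset (GLn n)} {η : ℝ}
    (hY : Y.Nonempty) (hZ : Z.Nonempty) (hsep : HasSeparators X Y Z s η)
    (hη : η * X.card < 1)
    (A₀ : Matrix (Fin n) (Fin n) ℂ) (A : Fin m → Matrix (Fin n) (Fin n) ℂ)
    (hX : ∀ x ∈ X, ∃ t : Fin m → ℂ, (x : Matrix (Fin n) (Fin n) ℂ) = A₀ + ∑ k, t k • A k) :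
    X.card ≤ (s + 1) ^ m := by
  classical
  obtain ⟨y₀, hy₀⟩ := hY
  obtain ⟨z₀, hz₀⟩ := hZ
  choose p hpdeg hpsep using hsep
  choose t ht using hX
  set M : Matrix (Fin n) (Fin n) ℂ := ((y₀⁻¹ * y₀ * z₀⁻¹ : GLn n) : Matrix (Fin n) (Fin n) ℂ)
    with hM
  set ℓ : Fin n × Fin n → MvPolynomial (Fin m) ℂ := fun ij =>
    MvPolynomial.C ((A₀ * M) ij.1 ij.2) + ∑ k, MvPolynomial.C ((A k * M) ij.1 ij.2) * MvPolynomial.X k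
    with hℓ
  have hℓdeg : ∀ ij, (ℓ ij).totalDegree ≤ 1 := by
    intro ij
    refine (MvPolynomial.totalDegree_add _ _).trans (max_le ?_ ?_)
    · rw [MvPolynomial.totalDegree_C]; exact Nat.zero_le _
    · refine MvPolynomial.totalDegree_finsetSum_le fun k _ => ?_
      refine (MvPolynomial.totalDegree_mul _ _).trans ?_
      rw [MvPolynomial.totalDegree_C, MvPolynomial.totalDegree_X, zero_add]
  have hPt : ∀ x : ↥X, pt x.1 y₀ y₀ z₀ = fun ij => MvPolynomial.eval (t x.1 x.2) (ℓ ij) := by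
    intro x; funext ij
    have hx : ((x.1 * y₀⁻¹ * y₀ * z₀⁻¹ : GLn n) : Matrix (Fin n) (Fin n) ℂ)
        = (x.1 : Matrix (Fin n) (Fin n) ℂ) * M := by
      simp only [hM, Units.val_mul, mul_assoc]
    simp only [pt, hℓ, map_add, map_sum, map_mul, MvPolynomial.eval_C, MvPolynomial.eval_X]
    rw [hx, ht x.1 x.2, Matrix.add_mul, Finset.sum_mul, Matrix.add_apply]
    congr 1
    rw [Matrix.sum_apply]
    refine Finset.sum_congr rfl fun k _ => ?_
    rw [Matrix.smul_mul, Matrix.smul_apply, smul_eq_mul, mul_comm]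
  set f : ↥X → ↥X → ℂ := fun i j => MvPolynomial.eval (pt j.1 y₀ y₀ z₀) (p i.1 i.2 z₀ hz₀) with hf
  set mono : (Fin m → Fin (s + 1)) → (↥X → ℂ) := fun μ j => ∏ k, (t j.1 j.2 k) ^ (μ k : ℕ)
    with hmono
  set W : Submodule ℂ (↥X → ℂ) := Submodule.span ℂ (Set.range mono) with hW
  have hWle : Module.finrank ℂ W ≤ (s + 1) ^ m := by
    have h := finrank_range_le_card (R := ℂ) mono
    simpa [W, Set.finrank, Fintype.card_fun, Fintype.card_fin] using h
  have hfW : ∀ i, f i ∈ W := by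
    intro i
    set Q := MvPolynomial.bind₁ ℓ (p i.1 i.2 z₀ hz₀) with hQ
    have hQdeg : Q.totalDegree ≤ s :=
      (totalDegree_bind₁_le_of_affine ℓ hℓdeg _).trans (hpdeg _ _ _ _)
    have hexp : f i = ∑ d ∈ Q.support, (MvPolynomial.coeff d Q) • (fun j => ∏ k, t j.1 j.2 k ^ d k) := by
      funext j
      simp only [f, Finset.sum_apply, Pi.smul_apply, smul_eq_mul]
      rw [hPt j, show MvPolynomial.eval (fun ij => MvPolynomial.eval (t j.1 j.2) (ℓ ij)) (p i.1 i.2 z₀ hz₀)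
          = MvPolynomial.eval (t j.1 j.2) Q from (MvPolynomial.eval₂Hom_bind₁ _ _ _ _).symm,
        MvPolynomial.eval_eq]
      refine Finset.sum_congr rfl fun d _ => ?_
      congr 1
      exact Finset.prod_subset (Finset.subset_univ _)
        (fun k _ hk => by rw [Finsupp.notMem_support_iff.mp hk, pow_zero])
    rw [hexp]
    refine Submodule.sum_mem _ fun d hd => Submodule.smul_mem _ _ (Submodule.subset_span ?_)
    refine ⟨fun k => ⟨d k, Nat.lt_succ_of_le ((apply_le_totalDegree hd k).trans hQdeg)⟩, ?_⟩
    funext j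
    simp [mono]
  have hcard : Fintype.card ↥X = X.card := by simp
  have key := card_le_finrank_of_approx_dual W f hfW η (by rw [hcard]; exact hη)
    (fun i => (hpsep i.1 i.2 z₀ hz₀ i.1 i.2 y₀ hy₀ y₀ hy₀ z₀ hz₀).1 ⟨rfl, rfl, rfl⟩)
    (fun i j hij => (hpsep i.1 i.2 z₀ hz₀ j.1 j.2 y₀ hy₀ y₀ hy₀ z₀ hz₀).2
      (fun h => hij (Subtype.ext h.1).symm))
  rw [hcard] at key
  exact key.trans hWle

/-- **Affine sub-family bound for `Y`.** If `X, Z ≠ ∅`, some target has an `η`-separator of degree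
`≤ s` with `η·|Y| < 1`, and `Y` lies in an affine subspace of `Mat_n(ℂ)` spanned by `m` matrices, then
`|Y| ≤ (s+1)^m`: the `|Y| × |Y|` matrix `p(x₀ y⁻¹ y' z₀⁻¹) ≈ 1` has rows polynomial of degree `≤ s` in
the `m` affine parameters of `y'`.  (So `Y` central / diagonal / abelian-unipotent is impossible for
the crux.) [folklore] -/
theorem card_Y_le_of_separators_affine {n m s : ℕ} {X Y Z : Finset (GLn n)} {η : ℝ}
    (hXne : X.Nonempty) (hZne : Z.Nonempty) (hsep : HasSeparators X Y Z s η)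
    (hη : η * Y.card < 1)
    (A₀ : Matrix (Fin n) (Fin n) ℂ) (A : Fin m → Matrix (Fin n) (Fin n) ℂ)
    (hY : ∀ y ∈ Y, ∃ t : Fin m → ℂ, (y : Matrix (Fin n) (Fin n) ℂ) = A₀ + ∑ k, t k • A k) :
    Y.card ≤ (s + 1) ^ m := by
  classical
  obtain ⟨x₀, hx₀⟩ := hXne
  obtain ⟨z₀, hz₀⟩ := hZne
  obtain ⟨p, hpdeg, hpsep⟩ := hsep x₀ hx₀ z₀ hz₀
  choose t ht using hY
  set R : Matrix (Fin n) (Fin n) ℂ := ((z₀⁻¹ : GLn n) : Matrix (Fin n) (Fin n) ℂ) with hR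
  set L : ↥Y → Matrix (Fin n) (Fin n) ℂ := fun y => ((x₀ * y.1⁻¹ : GLn n) : Matrix (Fin n) (Fin n) ℂ)
    with hL
  set ℓ : ↥Y → Fin n × Fin n → MvPolynomial (Fin m) ℂ := fun y ij =>
    MvPolynomial.C ((L y * A₀ * R) ij.1 ij.2) + ∑ k, MvPolynomial.C ((L y * A k * R) ij.1 ij.2) * MvPolynomial.X k
    with hℓ
  have hℓdeg : ∀ y ij, (ℓ y ij).totalDegree ≤ 1 := by
    intro y ij
    refine (MvPolynomial.totalDegree_add _ _).trans (max_le ?_ ?_)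
    · rw [MvPolynomial.totalDegree_C]; exact Nat.zero_le _
    · refine MvPolynomial.totalDegree_finsetSum_le fun k _ => ?_
      refine (MvPolynomial.totalDegree_mul _ _).trans ?_
      rw [MvPolynomial.totalDegree_C, MvPolynomial.totalDegree_X, zero_add]
  have hPt : ∀ y y' : ↥Y, pt x₀ y.1 y'.1 z₀ = fun ij => MvPolynomial.eval (t y'.1 y'.2) (ℓ y ij) := by
    intro y y'; funext ij
    have hx : ((x₀ * y.1⁻¹ * y'.1 * z₀⁻¹ : GLn n) : Matrix (Fin n) (Fin n) ℂ)
        = L y * (y'.1 : Matrix (Fin n) (Fin n) ℂ) * R := by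
      simp only [hL, hR, Units.val_mul]
    simp only [pt, hℓ, map_add, map_sum, map_mul, MvPolynomial.eval_C, MvPolynomial.eval_X]
    rw [hx, ht y'.1 y'.2, Matrix.mul_add, Matrix.add_mul, Matrix.mul_sum, Finset.sum_mul,
      Matrix.add_apply]
    congr 1
    rw [Matrix.sum_apply]
    refine Finset.sum_congr rfl fun k _ => ?_
    rw [Matrix.mul_smul, Matrix.smul_mul, Matrix.smul_apply, smul_eq_mul, mul_comm]
  set f : ↥Y → ↥Y → ℂ := fun y y' => MvPolynomial.eval (pt x₀ y.1 y'.1 z₀) p with hf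
  set mono : (Fin m → Fin (s + 1)) → (↥Y → ℂ) := fun μ j => ∏ k, (t j.1 j.2 k) ^ (μ k : ℕ)
    with hmono
  set W : Submodule ℂ (↥Y → ℂ) := Submodule.span ℂ (Set.range mono) with hW
  have hWle : Module.finrank ℂ W ≤ (s + 1) ^ m := by
    have h := finrank_range_le_card (R := ℂ) mono
    simpa [W, Set.finrank, Fintype.card_fun, Fintype.card_fin] using h
  have hfW : ∀ i, f i ∈ W := by
    intro i
    set Q := MvPolynomial.bind₁ (ℓ i) p with hQ
    have hQdeg : Q.totalDegree ≤ s := (totalDegree_bind₁_le_of_affine (ℓ i) (hℓdeg i) _).trans hpdeg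
    have hexp : f i = ∑ d ∈ Q.support, (MvPolynomial.coeff d Q) • (fun j => ∏ k, t j.1 j.2 k ^ d k) := by
      funext j
      simp only [f, Finset.sum_apply, Pi.smul_apply, smul_eq_mul]
      rw [hPt i j, show MvPolynomial.eval (fun ij => MvPolynomial.eval (t j.1 j.2) (ℓ i ij)) p
          = MvPolynomial.eval (t j.1 j.2) Q from (MvPolynomial.eval₂Hom_bind₁ _ _ _ _).symm,
        MvPolynomial.eval_eq]
      refine Finset.sum_congr rfl fun d _ => ?_
      congr 1
      exact Finset.prod_subset (Finset.subset_univ _)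
        (fun k _ hk => by rw [Finsupp.notMem_support_iff.mp hk, pow_zero])
    rw [hexp]
    refine Submodule.sum_mem _ fun d hd => Submodule.smul_mem _ _ (Submodule.subset_span ?_)
    refine ⟨fun k => ⟨d k, Nat.lt_succ_of_le ((apply_le_totalDegree hd k).trans hQdeg)⟩, ?_⟩
    funext j
    simp [mono]
  have hcard : Fintype.card ↥Y = Y.card := by simp
  have key := card_le_finrank_of_approx_dual W f hfW η (by rw [hcard]; exact hη)
    (fun i => (hpsep x₀ hx₀ i.1 i.2 i.1 i.2 z₀ hz₀).1 ⟨rfl, rfl, rfl⟩)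
    (fun i j hij => (hpsep x₀ hx₀ i.1 i.2 j.1 j.2 z₀ hz₀).2 (fun h => hij (Subtype.ext h.2.1)))
  rw [hcard] at key
  exact key.trans hWle

/-- **Affine sub-family bound for `Z` (through `Z⁻¹`).** If `X, Y ≠ ∅`, every target has an
`η`-separator of degree `≤ s` with `η·|Z| < 1`, and the INVERSES of the elements of `Z` lie in an affine
subspace of `Mat_n(ℂ)` spanned by `m` matrices (e.g. `Z` inside a translate of an algebraic subgroup
contained in an affine subspace: unitriangular, torus, vector group), then `|Z| ≤ (s+1)^m`.  (`Z` enters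
the sampled point `x y⁻¹ y' z⁻¹` only through `z⁻¹`, and `g ↦ g⁻¹` does not preserve polynomiality, so
the hypothesis is on `Z⁻¹`.) [folklore] -/
theorem card_Z_le_of_separators_affineInv {n m s : ℕ} {X Y Z : Finset (GLn n)} {η : ℝ}
    (hXne : X.Nonempty) (hY : Y.Nonempty) (hsep : HasSeparators X Y Z s η)
    (hη : η * Z.card < 1)
    (A₀ : Matrix (Fin n) (Fin n) ℂ) (A : Fin m → Matrix (Fin n) (Fin n) ℂ)
    (hZ : ∀ z ∈ Z, ∃ t : Fin m → ℂ, ((z⁻¹ : GLn n) : Matrix (Fin n) (Fin n) ℂ) = A₀ + ∑ k, t k • A k) :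
    Z.card ≤ (s + 1) ^ m := by
  classical
  obtain ⟨x₀, hx₀⟩ := hXne
  obtain ⟨y₀, hy₀⟩ := hY
  choose p hpdeg hpsep using hsep
  choose t ht using hZ
  set L : Matrix (Fin n) (Fin n) ℂ := ((x₀ * y₀⁻¹ * y₀ : GLn n) : Matrix (Fin n) (Fin n) ℂ) with hL
  set ℓ : Fin n × Fin n → MvPolynomial (Fin m) ℂ := fun ij =>
    MvPolynomial.C ((L * A₀) ij.1 ij.2) + ∑ k, MvPolynomial.C ((L * A k) ij.1 ij.2) * MvPolynomial.X k
    with hℓ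
  have hℓdeg : ∀ ij, (ℓ ij).totalDegree ≤ 1 := by
    intro ij
    refine (MvPolynomial.totalDegree_add _ _).trans (max_le ?_ ?_)
    · rw [MvPolynomial.totalDegree_C]; exact Nat.zero_le _
    · refine MvPolynomial.totalDegree_finsetSum_le fun k _ => ?_
      refine (MvPolynomial.totalDegree_mul _ _).trans ?_
      rw [MvPolynomial.totalDegree_C, MvPolynomial.totalDegree_X, zero_add]
  have hPt : ∀ z : ↥Z, pt x₀ y₀ y₀ z.1 = fun ij => MvPolynomial.eval (t z.1 z.2) (ℓ ij) := by
    intro z; funext ij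
    have hx : ((x₀ * y₀⁻¹ * y₀ * z.1⁻¹ : GLn n) : Matrix (Fin n) (Fin n) ℂ)
        = L * ((z.1⁻¹ : GLn n) : Matrix (Fin n) (Fin n) ℂ) := by
      simp only [hL, Units.val_mul]
    simp only [pt, hℓ, map_add, map_sum, map_mul, MvPolynomial.eval_C, MvPolynomial.eval_X]
    rw [hx, ht z.1 z.2, Matrix.mul_add, Matrix.mul_sum, Matrix.add_apply]
    congr 1
    rw [Matrix.sum_apply]
    refine Finset.sum_congr rfl fun k _ => ?_
    rw [Matrix.mul_smul, Matrix.smul_apply, smul_eq_mul, mul_comm]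
  set f : ↥Z → ↥Z → ℂ := fun i j => MvPolynomial.eval (pt x₀ y₀ y₀ j.1) (p x₀ hx₀ i.1 i.2) with hf
  set mono : (Fin m → Fin (s + 1)) → (↥Z → ℂ) := fun μ j => ∏ k, (t j.1 j.2 k) ^ (μ k : ℕ)
    with hmono
  set W : Submodule ℂ (↥Z → ℂ) := Submodule.span ℂ (Set.range mono) with hW
  have hWle : Module.finrank ℂ W ≤ (s + 1) ^ m := by
    have h := finrank_range_le_card (R := ℂ) mono
    simpa [W, Set.finrank, Fintype.card_fun, Fintype.card_fin] using h
  have hfW : ∀ i, f i ∈ W := by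
    intro i
    set Q := MvPolynomial.bind₁ ℓ (p x₀ hx₀ i.1 i.2) with hQ
    have hQdeg : Q.totalDegree ≤ s :=
      (totalDegree_bind₁_le_of_affine ℓ hℓdeg _).trans (hpdeg _ _ _ _)
    have hexp : f i = ∑ d ∈ Q.support, (MvPolynomial.coeff d Q) • (fun j => ∏ k, t j.1 j.2 k ^ d k) := by
      funext j
      simp only [f, Finset.sum_apply, Pi.smul_apply, smul_eq_mul]
      rw [hPt j, show MvPolynomial.eval (fun ij => MvPolynomial.eval (t j.1 j.2) (ℓ ij)) (p x₀ hx₀ i.1 i.2)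
          = MvPolynomial.eval (t j.1 j.2) Q from (MvPolynomial.eval₂Hom_bind₁ _ _ _ _).symm,
        MvPolynomial.eval_eq]
      refine Finset.sum_congr rfl fun d _ => ?_
      congr 1
      exact Finset.prod_subset (Finset.subset_univ _)
        (fun k _ hk => by rw [Finsupp.notMem_support_iff.mp hk, pow_zero])
    rw [hexp]
    refine Submodule.sum_mem _ fun d hd => Submodule.smul_mem _ _ (Submodule.subset_span ?_)
    refine ⟨fun k => ⟨d k, Nat.lt_succ_of_le ((apply_le_totalDegree hd k).trans hQdeg)⟩, ?_⟩
    funext j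
    simp [mono]
  have hcard : Fintype.card ↥Z = Z.card := by simp
  have key := card_le_finrank_of_approx_dual W f hfW η (by rw [hcard]; exact hη)
    (fun i => (hpsep x₀ hx₀ i.1 i.2 x₀ hx₀ y₀ hy₀ y₀ hy₀ i.1 i.2).1 ⟨rfl, rfl, rfl⟩)
    (fun i j hij => (hpsep x₀ hx₀ i.1 i.2 x₀ hx₀ y₀ hy₀ y₀ hy₀ j.1 j.2).2
      (fun h => hij (Subtype.ext h.2.2).symm))
  rw [hcard] at key
  exact key.trans hWle

/-- Real bookkeeping shared by the exponent-form kills: `q^a ≤ N ≤ (s+1)^m`, `s ≤ q^b`, `m ≤ μ`,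
`b μ < a` is impossible for large `q`. [folklore] -/
theorem counting_real_core {a b μ : ℝ} (hb : 0 ≤ b) (hab : b * μ < a) :
    ∃ q₀ : ℕ, ∀ q : ℕ, q₀ ≤ q → ∀ N s m : ℕ, (m : ℝ) ≤ μ → (q : ℝ) ^ a ≤ N → (s : ℝ) ≤ (q : ℝ) ^ b →
      ¬ (N ≤ (s + 1) ^ m) := by
  set γ : ℝ := a - b * μ with hγ
  have hγpos : 0 < γ := by rw [hγ]; linarith
  set B : ℝ := (2 : ℝ) ^ ((μ + 1) / γ) with hB
  refine ⟨⌈B⌉₊ + 2, fun q hq N s m hm hN hs hle => ?_⟩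
  have hqB : B ≤ q := le_trans (Nat.le_ceil B) (by exact_mod_cast (by omega : ⌈B⌉₊ ≤ q))
  have hq2 : (2 : ℝ) ≤ q := by exact_mod_cast (by omega : 2 ≤ q)
  have hq1 : (1 : ℝ) ≤ q := by linarith
  have hq0 : (0 : ℝ) < q := by linarith
  have hqb1 : (1 : ℝ) ≤ (q : ℝ) ^ b := Real.one_le_rpow hq1 hb
  have h1 : (q : ℝ) ^ a ≤ ((s : ℝ) + 1) ^ m := hN.trans (by exact_mod_cast hle)
  have h2 : ((s : ℝ) + 1) ^ m ≤ (2 * (q : ℝ) ^ b) ^ m := pow_le_pow_left₀ (by positivity) (by linarith) _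
  have h3 : (2 * (q : ℝ) ^ b) ^ m ≤ (2 : ℝ) ^ μ * (q : ℝ) ^ (b * μ) := by
    rw [mul_pow, ← Real.rpow_natCast ((q : ℝ) ^ b) m, ← Real.rpow_mul hq0.le,
      ← Real.rpow_natCast (2 : ℝ) m]
    refine mul_le_mul (Real.rpow_le_rpow_of_exponent_le (by norm_num) hm)
      (Real.rpow_le_rpow_of_exponent_le hq1 (mul_le_mul_of_nonneg_left hm hb))
      (by positivity) (by positivity)
  have h4 : (q : ℝ) ^ a = (q : ℝ) ^ γ * (q : ℝ) ^ (b * μ) := by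
    rw [← Real.rpow_add hq0]; congr 1; rw [hγ]; ring
  have h5 : (q : ℝ) ^ γ ≤ (2 : ℝ) ^ μ :=
    le_of_mul_le_mul_right (h4 ▸ (h1.trans (h2.trans h3))) (Real.rpow_pos_of_pos hq0 _)
  have h6 : B ^ γ ≤ (q : ℝ) ^ γ := Real.rpow_le_rpow (by positivity) hqB hγpos.le
  have h7 : B ^ γ = 2 * (2 : ℝ) ^ μ := by
    rw [hB, ← Real.rpow_mul (by norm_num : (0 : ℝ) ≤ 2), div_mul_cancel₀ _ hγpos.ne',
      Real.rpow_add (by norm_num : (0 : ℝ) < 2), Real.rpow_one, mul_comm]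
  have h8 : (0 : ℝ) < (2 : ℝ) ^ μ := by positivity
  linarith

/-- **No half-dimensional border designs with `X` in an affine subspace of dimension `≤ (n²−n)/2`.**
The crux strengthened by "`X ⊆ A₀ + span(A₁,…,A_m)` with `2m + n ≤ n²`" is FALSE — already at
`ε = 1/8`, `δ = 1/(4n)`: `q^(n²/2 − n/8) ≤ |X| ≤ (q^(1+δ) + 1)^((n²−n)/2)` fails for large `q`.
Dead on arrival for this crux: `X` (and likewise `Y`, `Z`) inside a translate `a·L·b` of the
unitriangular group, a maximal torus, a Borel unipotent radical, a block vector group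
`[[I,T],[0,I]]`, or `exp` of an abelian nilpotent Lie algebra (BCGPU's running-example hosts, which sit
exactly at `ε = 1/2`). [folklore] -/
theorem not_borderHalfDimensionDesigns_affineX :
    ¬ (∀ ε : ℝ, 0 < ε → ∃ n : ℕ, 3 ≤ n ∧ ∀ δ : ℝ, 0 < δ → ∀ q₀ : ℕ, ∃ q : ℕ, q₀ ≤ q ∧
        ∀ η : ℝ, 0 < η → ∃ X Y Z : Finset (GLn n), TPP X Y Z ∧
          (q : ℝ) ^ ((n : ℝ) ^ 2 / 2 - ε * n) ≤ (X.card : ℝ) ∧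
          (q : ℝ) ^ ((n : ℝ) ^ 2 / 2 - ε * n) ≤ (Y.card : ℝ) ∧
          (q : ℝ) ^ ((n : ℝ) ^ 2 / 2 - ε * n) ≤ (Z.card : ℝ) ∧
          (∀ x₀ ∈ X, ∀ z₀ ∈ Z, ∃ p : MvPolynomial (Fin n × Fin n) ℂ,
            (p.totalDegree : ℝ) ≤ (q : ℝ) ^ (1 + δ) ∧
            ∀ x ∈ X, ∀ y ∈ Y, ∀ y' ∈ Y, ∀ z ∈ Z,
              ((x = x₀ ∧ y = y' ∧ z = z₀) → ‖MvPolynomial.eval (pt x y y' z) p - 1‖ ≤ η) ∧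
              (¬ (x = x₀ ∧ y = y' ∧ z = z₀) → ‖MvPolynomial.eval (pt x y y' z) p‖ ≤ η)) ∧
          ∃ m : ℕ, 2 * m + n ≤ n ^ 2 ∧
            ∃ (A₀ : Matrix (Fin n) (Fin n) ℂ) (A : Fin m → Matrix (Fin n) (Fin n) ℂ),
              ∀ x ∈ X, ∃ t : Fin m → ℂ, (x : Matrix (Fin n) (Fin n) ℂ) = A₀ + ∑ k, t k • A k) := by
  intro H
  obtain ⟨n, hn3, Hn⟩ := H (1 / 8) (by norm_num)
  have hn : (3 : ℝ) ≤ n := by exact_mod_cast hn3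
  have hnpos : (0 : ℝ) < n := by linarith
  have Hδ := Hn (1 / (4 * n)) (by positivity)
  obtain ⟨q₀, hq₀⟩ := counting_real_core (a := (n : ℝ) ^ 2 / 2 - 1 / 8 * n) (b := 1 + 1 / (4 * n))
    (μ := ((n : ℝ) ^ 2 - n) / 2) (by positivity) (by
      have e : (1 + 1 / (4 * n)) * (((n : ℝ) ^ 2 - n) / 2)
          = ((n : ℝ) ^ 2 - n) / 2 + (n - 1) / 8 := by field_simp; ring
      rw [e]; nlinarith)
  obtain ⟨q, hq, Hq⟩ := Hδ (max q₀ 1)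
  have hq1 : (1 : ℝ) ≤ q := by exact_mod_cast le_trans (le_max_right q₀ 1) hq
  have hq0 : (0 : ℝ) < q := by linarith
  set a : ℝ := (n : ℝ) ^ 2 / 2 - 1 / 8 * n with ha
  set N : ℕ := ⌈(q : ℝ) ^ a⌉₊ with hN
  set s : ℕ := ⌊(q : ℝ) ^ ((1 : ℝ) + 1 / (4 * n))⌋₊ with hs
  have hqa : (0 : ℝ) < (q : ℝ) ^ a := Real.rpow_pos_of_pos hq0 a
  set η : ℝ := 1 / (2 * ((N : ℝ) + 1)) with hη
  have hηpos : 0 < η := by rw [hη]; positivity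
  obtain ⟨X, Y, Z, -, hX, hY, hZ, hsep, m, hm, A₀, A, hXaff⟩ := Hq η hηpos
  have hNX : N ≤ X.card := Nat.ceil_le.mpr hX
  have hYne : Y.Nonempty := by
    rw [← Finset.card_pos]
    have : (0 : ℝ) < Y.card := lt_of_lt_of_le (Real.rpow_pos_of_pos hq0 _) hY
    exact_mod_cast this
  have hZne : Z.Nonempty := by
    rw [← Finset.card_pos]
    have : (0 : ℝ) < Z.card := lt_of_lt_of_le (Real.rpow_pos_of_pos hq0 _) hZ
    exact_mod_cast this
  obtain ⟨X', hX'X, hX'card⟩ := Finset.exists_subset_card_eq hNX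
  have hsep' : HasSeparators X' Y Z s η := by
    intro x₀ hx₀ z₀ hz₀
    obtain ⟨p, hpdeg, hp⟩ := hsep x₀ (hX'X hx₀) z₀ hz₀
    exact ⟨p, Nat.le_floor hpdeg, fun x hx y hy y' hy' z hz => hp x (hX'X hx) y hy y' hy' z hz⟩
  have hηN : η * X'.card < 1 := by
    rw [hX'card, hη, div_mul_eq_mul_div, one_mul, div_lt_one (by positivity)]
    linarith
  have hbound := card_le_of_separators_affine hYne hZne hsep' hηN A₀ A
    (fun x hx => hXaff x (hX'X hx))
  rw [hX'card] at hbound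
  have hmμ : (m : ℝ) ≤ ((n : ℝ) ^ 2 - n) / 2 := by
    have : ((2 * m + n : ℕ) : ℝ) ≤ ((n ^ 2 : ℕ) : ℝ) := by exact_mod_cast hm
    push_cast at this
    linarith
  exact hq₀ q (le_trans (le_max_left _ _) hq) N s m hmμ (Nat.le_ceil _)
    (Nat.floor_le (by positivity)) hbound


/-- **No half-dimensional border designs with `Y` in an affine subspace of dimension `≤ (n²−n)/2`**
(in particular: `Y` central, `Y` diagonal, `Y` inside a vector group or a translate of the
unitriangular group).  Same counting as `not_borderHalfDimensionDesigns_affineX`, through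
`card_Y_le_of_separators_affine`. [folklore] -/
theorem not_borderHalfDimensionDesigns_affineY :
    ¬ (∀ ε : ℝ, 0 < ε → ∃ n : ℕ, 3 ≤ n ∧ ∀ δ : ℝ, 0 < δ → ∀ q₀ : ℕ, ∃ q : ℕ, q₀ ≤ q ∧
        ∀ η : ℝ, 0 < η → ∃ X Y Z : Finset (GLn n), TPP X Y Z ∧
          (q : ℝ) ^ ((n : ℝ) ^ 2 / 2 - ε * n) ≤ (X.card : ℝ) ∧
          (q : ℝ) ^ ((n : ℝ) ^ 2 / 2 - ε * n) ≤ (Y.card : ℝ) ∧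
          (q : ℝ) ^ ((n : ℝ) ^ 2 / 2 - ε * n) ≤ (Z.card : ℝ) ∧
          (∀ x₀ ∈ X, ∀ z₀ ∈ Z, ∃ p : MvPolynomial (Fin n × Fin n) ℂ,
            (p.totalDegree : ℝ) ≤ (q : ℝ) ^ (1 + δ) ∧
            ∀ x ∈ X, ∀ y ∈ Y, ∀ y' ∈ Y, ∀ z ∈ Z,
              ((x = x₀ ∧ y = y' ∧ z = z₀) → ‖MvPolynomial.eval (pt x y y' z) p - 1‖ ≤ η) ∧
              (¬ (x = x₀ ∧ y = y' ∧ z = z₀) → ‖MvPolynomial.eval (pt x y y' z) p‖ ≤ η)) ∧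
          ∃ m : ℕ, 2 * m + n ≤ n ^ 2 ∧
            ∃ (A₀ : Matrix (Fin n) (Fin n) ℂ) (A : Fin m → Matrix (Fin n) (Fin n) ℂ),
              ∀ y ∈ Y, ∃ t : Fin m → ℂ, (y : Matrix (Fin n) (Fin n) ℂ) = A₀ + ∑ k, t k • A k) := by
  intro H
  obtain ⟨n, hn3, Hn⟩ := H (1 / 8) (by norm_num)
  have hn : (3 : ℝ) ≤ n := by exact_mod_cast hn3
  have hnpos : (0 : ℝ) < n := by linarith
  have Hδ := Hn (1 / (4 * n)) (by positivity)
  obtain ⟨q₀, hq₀⟩ := counting_real_core (a := (n : ℝ) ^ 2 / 2 - 1 / 8 * n) (b := 1 + 1 / (4 * n))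
    (μ := ((n : ℝ) ^ 2 - n) / 2) (by positivity) (by
      have e : (1 + 1 / (4 * n)) * (((n : ℝ) ^ 2 - n) / 2)
          = ((n : ℝ) ^ 2 - n) / 2 + (n - 1) / 8 := by field_simp; ring
      rw [e]; nlinarith)
  obtain ⟨q, hq, Hq⟩ := Hδ (max q₀ 1)
  have hq1 : (1 : ℝ) ≤ q := by exact_mod_cast le_trans (le_max_right q₀ 1) hq
  have hq0 : (0 : ℝ) < q := by linarith
  set a : ℝ := (n : ℝ) ^ 2 / 2 - 1 / 8 * n with ha
  set N : ℕ := ⌈(q : ℝ) ^ a⌉₊ with hN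
  set s : ℕ := ⌊(q : ℝ) ^ ((1 : ℝ) + 1 / (4 * n))⌋₊ with hs
  have hqa : (0 : ℝ) < (q : ℝ) ^ a := Real.rpow_pos_of_pos hq0 a
  set η : ℝ := 1 / (2 * ((N : ℝ) + 1)) with hη
  have hηpos : 0 < η := by rw [hη]; positivity
  obtain ⟨X, Y, Z, -, hX, hY, hZ, hsep, m, hm, A₀, A, hYaff⟩ := Hq η hηpos
  have hNY : N ≤ Y.card := Nat.ceil_le.mpr hY
  have hXne : X.Nonempty := by
    rw [← Finset.card_pos]
    have : (0 : ℝ) < X.card := lt_of_lt_of_le (Real.rpow_pos_of_pos hq0 _) hX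
    exact_mod_cast this
  have hZne : Z.Nonempty := by
    rw [← Finset.card_pos]
    have : (0 : ℝ) < Z.card := lt_of_lt_of_le (Real.rpow_pos_of_pos hq0 _) hZ
    exact_mod_cast this
  obtain ⟨Y', hY'Y, hY'card⟩ := Finset.exists_subset_card_eq hNY
  have hsep' : HasSeparators X Y' Z s η := by
    intro x₀ hx₀ z₀ hz₀
    obtain ⟨p, hpdeg, hp⟩ := hsep x₀ hx₀ z₀ hz₀
    exact ⟨p, Nat.le_floor hpdeg,
      fun x hx y hy y' hy' z hz => hp x hx y (hY'Y hy) y' (hY'Y hy') z hz⟩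
  have hηN : η * Y'.card < 1 := by
    rw [hY'card, hη, div_mul_eq_mul_div, one_mul, div_lt_one (by positivity)]
    linarith
  have hbound := card_Y_le_of_separators_affine hXne hZne hsep' hηN A₀ A
    (fun y hy => hYaff y (hY'Y hy))
  rw [hY'card] at hbound
  have hmμ : (m : ℝ) ≤ ((n : ℝ) ^ 2 - n) / 2 := by
    have : ((2 * m + n : ℕ) : ℝ) ≤ ((n ^ 2 : ℕ) : ℝ) := by exact_mod_cast hm
    push_cast at this
    linarith
  exact hq₀ q (le_trans (le_max_left _ _) hq) N s m hmμ (Nat.le_ceil _)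
    (Nat.floor_le (by positivity)) hbound

/-- **No half-dimensional border designs with `Z⁻¹` in an affine subspace of dimension `≤ (n²−n)/2`**
(`Z` inside a translate of the unitriangular group, a torus, a vector group …).  Same counting, through
`card_Z_le_of_separators_affineInv`. [folklore] -/
theorem not_borderHalfDimensionDesigns_affineZinv :
    ¬ (∀ ε : ℝ, 0 < ε → ∃ n : ℕ, 3 ≤ n ∧ ∀ δ : ℝ, 0 < δ → ∀ q₀ : ℕ, ∃ q : ℕ, q₀ ≤ q ∧
        ∀ η : ℝ, 0 < η → ∃ X Y Z : Finset (GLn n), TPP X Y Z ∧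
          (q : ℝ) ^ ((n : ℝ) ^ 2 / 2 - ε * n) ≤ (X.card : ℝ) ∧
          (q : ℝ) ^ ((n : ℝ) ^ 2 / 2 - ε * n) ≤ (Y.card : ℝ) ∧
          (q : ℝ) ^ ((n : ℝ) ^ 2 / 2 - ε * n) ≤ (Z.card : ℝ) ∧
          (∀ x₀ ∈ X, ∀ z₀ ∈ Z, ∃ p : MvPolynomial (Fin n × Fin n) ℂ,
            (p.totalDegree : ℝ) ≤ (q : ℝ) ^ (1 + δ) ∧
            ∀ x ∈ X, ∀ y ∈ Y, ∀ y' ∈ Y, ∀ z ∈ Z,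
              ((x = x₀ ∧ y = y' ∧ z = z₀) → ‖MvPolynomial.eval (pt x y y' z) p - 1‖ ≤ η) ∧
              (¬ (x = x₀ ∧ y = y' ∧ z = z₀) → ‖MvPolynomial.eval (pt x y y' z) p‖ ≤ η)) ∧
          ∃ m : ℕ, 2 * m + n ≤ n ^ 2 ∧
            ∃ (A₀ : Matrix (Fin n) (Fin n) ℂ) (A : Fin m → Matrix (Fin n) (Fin n) ℂ),
              ∀ z ∈ Z, ∃ t : Fin m → ℂ, ((z⁻¹ : GLn n) : Matrix (Fin n) (Fin n) ℂ) = A₀ + ∑ k, t k • A k) := by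
  intro H
  obtain ⟨n, hn3, Hn⟩ := H (1 / 8) (by norm_num)
  have hn : (3 : ℝ) ≤ n := by exact_mod_cast hn3
  have hnpos : (0 : ℝ) < n := by linarith
  have Hδ := Hn (1 / (4 * n)) (by positivity)
  obtain ⟨q₀, hq₀⟩ := counting_real_core (a := (n : ℝ) ^ 2 / 2 - 1 / 8 * n) (b := 1 + 1 / (4 * n))
    (μ := ((n : ℝ) ^ 2 - n) / 2) (by positivity) (by
      have e : (1 + 1 / (4 * n)) * (((n : ℝ) ^ 2 - n) / 2)
          = ((n : ℝ) ^ 2 - n) / 2 + (n - 1) / 8 := by field_simp; ring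
      rw [e]; nlinarith)
  obtain ⟨q, hq, Hq⟩ := Hδ (max q₀ 1)
  have hq1 : (1 : ℝ) ≤ q := by exact_mod_cast le_trans (le_max_right q₀ 1) hq
  have hq0 : (0 : ℝ) < q := by linarith
  set a : ℝ := (n : ℝ) ^ 2 / 2 - 1 / 8 * n with ha
  set N : ℕ := ⌈(q : ℝ) ^ a⌉₊ with hN
  set s : ℕ := ⌊(q : ℝ) ^ ((1 : ℝ) + 1 / (4 * n))⌋₊ with hs
  have hqa : (0 : ℝ) < (q : ℝ) ^ a := Real.rpow_pos_of_pos hq0 a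
  set η : ℝ := 1 / (2 * ((N : ℝ) + 1)) with hη
  have hηpos : 0 < η := by rw [hη]; positivity
  obtain ⟨X, Y, Z, -, hX, hY, hZ, hsep, m, hm, A₀, A, hZaff⟩ := Hq η hηpos
  have hNZ : N ≤ Z.card := Nat.ceil_le.mpr hZ
  have hXne : X.Nonempty := by
    rw [← Finset.card_pos]
    have : (0 : ℝ) < X.card := lt_of_lt_of_le (Real.rpow_pos_of_pos hq0 _) hX
    exact_mod_cast this
  have hYne : Y.Nonempty := by
    rw [← Finset.card_pos]
    have : (0 : ℝ) < Y.card := lt_of_lt_of_le (Real.rpow_pos_of_pos hq0 _) hY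
    exact_mod_cast this
  obtain ⟨Z', hZ'Z, hZ'card⟩ := Finset.exists_subset_card_eq hNZ
  have hsep' : HasSeparators X Y Z' s η := by
    intro x₀ hx₀ z₀ hz₀
    obtain ⟨p, hpdeg, hp⟩ := hsep x₀ hx₀ z₀ (hZ'Z hz₀)
    exact ⟨p, Nat.le_floor hpdeg,
      fun x hx y hy y' hy' z hz => hp x hx y hy y' hy' z (hZ'Z hz)⟩
  have hηN : η * Z'.card < 1 := by
    rw [hZ'card, hη, div_mul_eq_mul_div, one_mul, div_lt_one (by positivity)]
    linarith
  have hbound := card_Z_le_of_separators_affineInv hXne hYne hsep' hηN A₀ A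
    (fun z hz => hZaff z (hZ'Z hz))
  rw [hZ'card] at hbound
  have hmμ : (m : ℝ) ≤ ((n : ℝ) ^ 2 - n) / 2 := by
    have : ((2 * m + n : ℕ) : ℝ) ≤ ((n ^ 2 : ℕ) : ℝ) := by exact_mod_cast hm
    push_cast at this
    linarith
  exact hq₀ q (le_trans (le_max_left _ _) hq) N s m hmμ (Nat.le_ceil _)
    (Nat.floor_le (by positivity)) hbound

/-! ## (d) Relation to the crux as typed in the route file

`HasSeparators`/`TPP`/`pt` are literally the crux's clauses (`Iff.rfl` up to unfolding), so every
theorem above is about `BorderHalfDimensionDesigns` itself.  The two sanity transfers: -/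

open Summit.MatrixMultiplication.MatrixMultiplication.Theses.GLnSeparatingDesigns in
/-- The crux, restated through the named clauses (definitional). -/
theorem borderHalfDimensionDesigns_iff :
    BorderHalfDimensionDesigns ↔
    (∀ ε : ℝ, 0 < ε → ∃ n : ℕ, 3 ≤ n ∧ ∀ δ : ℝ, 0 < δ → ∀ q₀ : ℕ, ∃ q : ℕ, q₀ ≤ q ∧
        ∀ η : ℝ, 0 < η → ∃ X Y Z : Finset (GLn n), TPP X Y Z ∧
          (q : ℝ) ^ ((n : ℝ) ^ 2 / 2 - ε * n) ≤ (X.card : ℝ) ∧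
          (q : ℝ) ^ ((n : ℝ) ^ 2 / 2 - ε * n) ≤ (Y.card : ℝ) ∧
          (q : ℝ) ^ ((n : ℝ) ^ 2 / 2 - ε * n) ≤ (Z.card : ℝ) ∧
          ∀ x₀ ∈ X, ∀ z₀ ∈ Z, ∃ p : MvPolynomial (Fin n × Fin n) ℂ,
            (p.totalDegree : ℝ) ≤ (q : ℝ) ^ (1 + δ) ∧
            ∀ x ∈ X, ∀ y ∈ Y, ∀ y' ∈ Y, ∀ z ∈ Z,
              ((x = x₀ ∧ y = y' ∧ z = z₀) → ‖MvPolynomial.eval (pt x y y' z) p - 1‖ ≤ η) ∧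
              (¬ (x = x₀ ∧ y = y' ∧ z = z₀) → ‖MvPolynomial.eval (pt x y y' z) p‖ ≤ η)) :=
  Iff.rfl

open Summit.MatrixMultiplication.MatrixMultiplication.Theses.GLnSeparatingDesigns in
/-- **The TPP conjunct can be dropped** (it is recovered from the separators at `η < 1/2`):
the crux is equivalent to its TPP-free version. -/
theorem borderHalfDimensionDesigns_iff_withoutTPP :
    BorderHalfDimensionDesigns ↔
    (∀ ε : ℝ, 0 < ε → ∃ n : ℕ, 3 ≤ n ∧ ∀ δ : ℝ, 0 < δ → ∀ q₀ : ℕ, ∃ q : ℕ, q₀ ≤ q ∧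
        ∀ η : ℝ, 0 < η → ∃ X Y Z : Finset (GLn n),
          (q : ℝ) ^ ((n : ℝ) ^ 2 / 2 - ε * n) ≤ (X.card : ℝ) ∧
          (q : ℝ) ^ ((n : ℝ) ^ 2 / 2 - ε * n) ≤ (Y.card : ℝ) ∧
          (q : ℝ) ^ ((n : ℝ) ^ 2 / 2 - ε * n) ≤ (Z.card : ℝ) ∧
          ∀ x₀ ∈ X, ∀ z₀ ∈ Z, ∃ p : MvPolynomial (Fin n × Fin n) ℂ,
            (p.totalDegree : ℝ) ≤ (q : ℝ) ^ (1 + δ) ∧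
            ∀ x ∈ X, ∀ y ∈ Y, ∀ y' ∈ Y, ∀ z ∈ Z,
              ((x = x₀ ∧ y = y' ∧ z = z₀) → ‖MvPolynomial.eval (pt x y y' z) p - 1‖ ≤ η) ∧
              (¬ (x = x₀ ∧ y = y' ∧ z = z₀) → ‖MvPolynomial.eval (pt x y y' z) p‖ ≤ η)) := by
  constructor
  · intro H ε hε
    obtain ⟨n, hn, Hn⟩ := H ε hε
    refine ⟨n, hn, fun δ hδ q₀ => ?_⟩
    obtain ⟨q, hq, Hq⟩ := Hn δ hδ q₀
    refine ⟨q, hq, fun η hη => ?_⟩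
    obtain ⟨X, Y, Z, -, hX, hY, hZ, hsep⟩ := Hq η hη
    exact ⟨X, Y, Z, hX, hY, hZ, hsep⟩
  · intro H ε hε
    obtain ⟨n, hn, Hn⟩ := H ε hε
    refine ⟨n, hn, fun δ hδ q₀ => ?_⟩
    obtain ⟨q, hq, Hq⟩ := Hn δ hδ q₀
    refine ⟨q, hq, fun η hη => ?_⟩
    obtain ⟨X, Y, Z, hX, hY, hZ, hsep⟩ := Hq (min η (1 / 4)) (lt_min hη (by norm_num))
    have hsepS : HasSeparators X Y Z ⌊(q : ℝ) ^ (1 + δ)⌋₊ (min η (1 / 4)) := fun x₀ hx₀ z₀ hz₀ => by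
      obtain ⟨p, hpdeg, hp⟩ := hsep x₀ hx₀ z₀ hz₀
      exact ⟨p, Nat.le_floor hpdeg, hp⟩
    refine ⟨X, Y, Z, tpp_of_separators (by
      have := min_le_right η (1 / 4); linarith) hsepS, hX, hY, hZ, fun x₀ hx₀ z₀ hz₀ => ?_⟩
    obtain ⟨p, hpdeg, hp⟩ := hsep x₀ hx₀ z₀ hz₀
    refine ⟨p, hpdeg, fun x hx y hy y' hy' z hz => ⟨fun h => ?_, fun h => ?_⟩⟩
    · exact ((hp x hx y hy y' hy' z hz).1 h).trans (min_le_left _ _)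
    · exact ((hp x hx y hy y' hy' z hz).2 h).trans (min_le_left _ _)

end Summit.MatrixMultiplication.MatrixMultiplication.Cruxes.BorderHalfDimensionDesigns.Disproof
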